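import Literature.RepresentationTheory.HeisenbergGroup.StoneVonNeumannLatticePair
import HarnessLib

/-!
# Schur's lemma for the lattice-pair Heisenberg group without spectral theory: the lattice-fixed line, scalar commutant,
# and the uniqueness of the Stone–von Neumann intertwiner up to a scalar of modulus one

Topic `RepresentationTheory/HeisenbergGroup`; namespace `Literature.RepresentationTheory.HeisenbergGroup`.  KERNEL ONLY:
theorems; no definition, no named fact, no record, no `sorry`.

Setting of `StoneVonNeumannLatticePair.lean`: `H = Heisenberg (polar β)` for a pairing `β : X →ₗ[R] Y →ₗ[R] R`, `ψ` a
character of `R`, `(B₁, B₂)` a dual lattice pair for `ψ(β x y)`, and representations `π` of `H` on complex Hilbert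
spaces by linear isometries with central character `ψ`.  [MoeglinVignerasWaldspurger1987, Chap. 2 I.6]: "`S(ψ_A)` est
de dimension 1" for the self-dual lattice `A = B₁ × B₂` in the irreducible `ψ`-representation; [ibid., Chap. 2 I.2 /
II.1 (A)]: the intertwiner of the Stone–von Neumann theorem is unique up to a scalar, so that the group of pairs
`(g, M_g)` is a central extension of `Sp(W)` by `ℂˣ` ([GelbartRogawski1991, §3.1 p. 454 L25–27]
"`0 ⟶ ℂ* ⟶ Mp_𝐀(W) ⟶ Sp_𝐀(W) ⟶ 0`").  This file proves these WITHOUT the spectral theorem (which Mathlib does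
not offer for bounded normal operators): the forced coefficients of `StoneVonNeumannLatticePair.lean` §2 do the work.

* §1 **the lattice-fixed line** (`latticeFixed_eq_zero_of_inner_eq_zero`, `exists_latticeFixed_eq_smul`): in an
  irreducible `π` (no closed invariant subspace other than `⊥`, `⊤`) with a lattice-fixed `v₀ ≠ 0`, every lattice-fixed
  `v₁` is a multiple of `v₀` — `⟪π(h) v₀, v₁⟫ = 1_{B₁ × B₂}(h) conj ψ(t) ⟪v₀, v₁⟫` vanishes identically once `v₁ ⊥ v₀`,
  and `v₀` is cyclic;
* §2 **scalar commutant** (`exists_commutant_eq_smul`): a bounded operator commuting with `π(H)` is a scalar — it maps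
  the lattice-fixed line to itself, so acts on `v₀` by a scalar `c`, hence by `c` on the dense span of the orbit;
* §3 **the intertwiner is unique up to `S¹`** (`linearIsometryEquiv_unique_of_isDualLatticePair`): two unitary
  intertwiners `U₁, U₂ : E₁ ≃ E₂` between irreducible `ψ`-representations satisfy `U₂ = c • U₁`, `‖c‖ = 1` — the
  abstract form of the tree's `StoneVonNeumannUniqueness.linearIsometryEquiv_schrodingerL2_unique` (there via the
  scalar commutant of the Schrödinger MODEL), valid at every finite place and over the finite adèles alike.

Nothing of the cited sources is asserted; everything is proved from Mathlib and the tree.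

## References
* [MoeglinVignerasWaldspurger1987] C. Mœglin, M.-F. Vignéras, J.-L. Waldspurger, LNM 1291 (1987), Chap. 2 I.2, I.6
  ("`S(ψ_A)` est de dimension 1"), II.1 (A).
* [GelbartRogawski1991] S. Gelbart, J. Rogawski, Invent. Math. 105 (1991), §3.1 p. 454 L21–27.
* [Dixmier1977] J. Dixmier, *C*-algebras*, North-Holland (1977), §13.1.1 (cyclic vectors), 2.3.1 (Schur).
-/

set_option autoImplicit false

noncomputable section

open Set Filter Topology
open scoped Pointwise InnerProductSpace ComplexConjugate

namespace Literature.RepresentationTheory.HeisenbergGroup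

open Literature.RepresentationTheory.Unitary

variable {R : Type*} [CommRing R] {X Y : Type*} [AddCommGroup X] [Module R X] [AddCommGroup Y] [Module R Y]
  [TopologicalSpace X] [TopologicalSpace Y] (β : X →ₗ[R] Y →ₗ[R] R) (ψ : AddChar R Circle)
  {B₁ : AddSubgroup X} {B₂ : AddSubgroup Y}

/-! ## §1 The lattice-fixed line -/

section Line

variable {E : Type*} [NormedAddCommGroup E] [InnerProductSpace ℂ E] (π : Representation ℂ (Heisenberg (polar β)) E)
  (hπu : ∀ (h : Heisenberg (polar β)) (v : E), ‖π h v‖ = ‖v‖)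
  (hπz : ∀ (t : R) (v : E), π (Heisenberg.ofCenter (polar β) (Multiplicative.ofAdd t)) v = ((ψ t : Circle) : ℂ) • v)
  (hπi : ∀ K : Submodule ℂ E, IsClosed (K : Set E) →
    (∀ (h : Heisenberg (polar β)), ∀ v ∈ K, π h v ∈ K) → K = ⊥ ∨ K = ⊤)
  {v₀ v₁ : E} (hv₀ : v₀ ≠ 0) (hτ₀ : ∀ x ∈ B₁, π ⟨(x, 0), 0⟩ v₀ = v₀) (hμ₀ : ∀ y ∈ B₂, π ⟨(0, y), 0⟩ v₀ = v₀)
  (hτ₁ : ∀ x ∈ B₁, π ⟨(x, 0), 0⟩ v₁ = v₁) (hμ₁ : ∀ y ∈ B₂, π ⟨(0, y), 0⟩ v₁ = v₁)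
include hπu hπz hπi hv₀ hτ₀ hμ₀ hτ₁ hμ₁

/-- **a lattice-fixed vector orthogonal to a non-zero lattice-fixed vector of an irreducible representation vanishes**:
all the coefficients `⟪π(h) v₀, v₁⟫` vanish (`inner_apply_latticeFixed_latticeFixed`), and the orbit of `v₀` spans a
dense subspace. [cite: MoeglinVignerasWaldspurger1987, Chap. 2 I.6] -/
theorem latticeFixed_eq_zero_of_inner_eq_zero (hB : IsDualLatticePair β ψ B₁ B₂) (h0 : ⟪v₀, v₁⟫_ℂ = 0) : v₁ = 0 := by
  have hco : ∀ h : Heisenberg (polar β), ⟪π h v₀, v₁⟫_ℂ = 0 := fun h => by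
    rw [inner_apply_latticeFixed_latticeFixed β ψ π hπu hπz hτ₀ hμ₀ hτ₁ hμ₁ hB h, h0, mul_zero]
  have hd := Unitary.dense_span_orbit_of_irreducible π hπu hπi hv₀
  have h1 : ∀ x ∈ Submodule.span ℂ (Set.range fun g => π g v₀), ⟪x, v₁⟫_ℂ = 0 := by
    intro x hx
    refine Submodule.span_induction ?_ ?_ ?_ ?_ hx
    · rintro _ ⟨g, rfl⟩
      exact hco g
    · exact inner_zero_left _
    · intro x y _ _ hx hy
      rw [inner_add_left, hx, hy, add_zero]
    · intro a x _ hx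
      rw [inner_smul_left, hx, mul_zero]
  have hS : IsClosed {x : E | ⟪x, v₁⟫_ℂ = 0} := isClosed_eq (continuous_id.inner continuous_const) continuous_const
  have huniv : closure (Submodule.span ℂ (Set.range fun g => π g v₀) : Set E) ⊆ {x : E | ⟪x, v₁⟫_ℂ = 0} :=
    closure_minimal (fun x hx => h1 x hx) hS
  rw [hd.closure_eq] at huniv
  exact inner_self_eq_zero.1 (huniv (Set.mem_univ v₁))

/-- **the lattice-fixed vectors of an irreducible representation form a line** ("`S(ψ_A)` est de dimension 1"): every
lattice-fixed `v₁` is `c • v₀` with `c = ⟪v₀, v₁⟫ / ⟪v₀, v₀⟫`. [cite: MoeglinVignerasWaldspurger1987, Chap. 2 I.6] -/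
theorem exists_latticeFixed_eq_smul (hB : IsDualLatticePair β ψ B₁ B₂) : ∃ c : ℂ, v₁ = c • v₀ := by
  set c : ℂ := ⟪v₀, v₁⟫_ℂ / ⟪v₀, v₀⟫_ℂ with hc
  refine ⟨c, ?_⟩
  have hvv : ⟪v₀, v₀⟫_ℂ ≠ 0 := inner_self_ne_zero.2 hv₀
  -- `w = v₁ - c v₀` is lattice-fixed and orthogonal to `v₀`
  have hwτ : ∀ x ∈ B₁, π ⟨(x, 0), 0⟩ (v₁ - c • v₀) = v₁ - c • v₀ := fun x hx => by
    rw [map_sub, map_smul, hτ₁ x hx, hτ₀ x hx]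
  have hwμ : ∀ y ∈ B₂, π ⟨(0, y), 0⟩ (v₁ - c • v₀) = v₁ - c • v₀ := fun y hy => by
    rw [map_sub, map_smul, hμ₁ y hy, hμ₀ y hy]
  have hw0 : ⟪v₀, v₁ - c • v₀⟫_ℂ = 0 := by
    rw [inner_sub_right, inner_smul_right, hc, div_mul_cancel₀ _ hvv, sub_self]
  have hw := latticeFixed_eq_zero_of_inner_eq_zero β ψ π hπu hπz hπi hv₀ hτ₀ hμ₀ hwτ hwμ hB hw0
  rwa [sub_eq_zero] at hw

end Line

/-! ## §2 The commutant is scalar -/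

section Commutant

variable [IsTopologicalAddGroup X] [ContinuousConstSMul R X] [IsTopologicalAddGroup Y] [ContinuousConstSMul R Y]
  {E : Type*} [NormedAddCommGroup E] [InnerProductSpace ℂ E] [CompleteSpace E]

/-- **Schur's lemma for the lattice-pair Heisenberg group**: for an irreducible unitary `ψ`-representation `π` on `E ≠ 0`
(continuous orbit maps, dual lattice pair with shrinking unit scalings), every bounded operator `A` commuting with `π(H)`
is a scalar: `A` preserves the lattice-fixed line, so `A v₀ = c v₀`, hence `A = c` on the dense span of the orbit of
`v₀`. [cite: MoeglinVignerasWaldspurger1987, Chap. 2 I.6] -/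
theorem exists_commutant_eq_smul [Nontrivial E] (hB : IsDualLatticePair β ψ B₁ B₂)
    (hX : ∀ N ∈ 𝓝 (0 : X), ∃ a : Rˣ, (((a : R) • B₁ : AddSubgroup X) : Set X) ⊆ N)
    (hY : ∀ N ∈ 𝓝 (0 : Y), ∃ a : Rˣ, (((a : R) • B₂ : AddSubgroup Y) : Set Y) ⊆ N)
    (π : Representation ℂ (Heisenberg (polar β)) E)
    (hπu : ∀ (h : Heisenberg (polar β)) (v : E), ‖π h v‖ = ‖v‖)
    (hπc : ∀ v : E, Continuous fun w : X × Y => π ⟨w, 0⟩ v)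
    (hπz : ∀ (t : R) (v : E), π (Heisenberg.ofCenter (polar β) (Multiplicative.ofAdd t)) v = ((ψ t : Circle) : ℂ) • v)
    (hπi : ∀ K : Submodule ℂ E, IsClosed (K : Set E) →
      (∀ (h : Heisenberg (polar β)), ∀ v ∈ K, π h v ∈ K) → K = ⊥ ∨ K = ⊤)
    (A : E →L[ℂ] E) (hA : ∀ (h : Heisenberg (polar β)) (v : E), A (π h v) = π h (A v)) :
    ∃ c : ℂ, ∀ v : E, A v = c • v := by
  obtain ⟨v₀, hv₀, hτ₀, hμ₀⟩ := exists_latticeFixed_ne_zero_of_isDualLatticePair β ψ π hB hX hY hπu hπc hπz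
  -- `A v₀` is lattice-fixed, hence a multiple of `v₀`
  have hτ₁ : ∀ x ∈ B₁, π ⟨(x, 0), 0⟩ (A v₀) = A v₀ := fun x hx => by rw [← hA, hτ₀ x hx]
  have hμ₁ : ∀ y ∈ B₂, π ⟨(0, y), 0⟩ (A v₀) = A v₀ := fun y hy => by rw [← hA, hμ₀ y hy]
  obtain ⟨c, hc⟩ := exists_latticeFixed_eq_smul β ψ π hπu hπz hπi hv₀ hτ₀ hμ₀ hτ₁ hμ₁ hB
  refine ⟨c, fun v => ?_⟩
  -- `A = c` on the orbit of `v₀`, hence on its dense span, hence everywhere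
  have hd := Unitary.dense_span_orbit_of_irreducible π hπu hπi hv₀
  have hAc : A = c • ContinuousLinearMap.id ℂ E := by
    refine ContinuousLinearMap.ext_on hd ?_
    rintro _ ⟨h, rfl⟩
    show A (π h v₀) = (c • ContinuousLinearMap.id ℂ E) (π h v₀)
    rw [hA, hc, map_smul, smul_apply, ContinuousLinearMap.id_apply]
  rw [hAc, smul_apply, ContinuousLinearMap.id_apply]

/-! ## §3 The Stone–von Neumann intertwiner is unique up to a scalar of modulus one -/

/-- **the unitary intertwiner is unique up to `S¹`**: if `U₁, U₂ : E₁ ≃ₗᵢ[ℂ] E₂` both intertwine the `ψ`-representations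
`π₁` (irreducible, on `E₁ ≠ 0`) and `π₂`, then `U₂ = c • U₁` with `‖c‖ = 1` (Schur for `U₁⁻¹ U₂ ∈ π₁(H)'`) — "à
isomorphisme près … une et une seule", the isomorphism itself determined up to `S¹`; whence the kernel `ℂˣ` of the
projection `(g, M_g) ↦ g` of the group of pairs.
[cite: MoeglinVignerasWaldspurger1987, Chap. 2 I.2 Théorème (Stone, Von Neumann), II.1 (A)] -/
theorem linearIsometryEquiv_unique_of_isDualLatticePair [Nontrivial E] (hB : IsDualLatticePair β ψ B₁ B₂)
    (hX : ∀ N ∈ 𝓝 (0 : X), ∃ a : Rˣ, (((a : R) • B₁ : AddSubgroup X) : Set X) ⊆ N)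
    (hY : ∀ N ∈ 𝓝 (0 : Y), ∃ a : Rˣ, (((a : R) • B₂ : AddSubgroup Y) : Set Y) ⊆ N)
    (π₁ : Representation ℂ (Heisenberg (polar β)) E)
    (h₁u : ∀ (h : Heisenberg (polar β)) (v : E), ‖π₁ h v‖ = ‖v‖)
    (h₁c : ∀ v : E, Continuous fun w : X × Y => π₁ ⟨w, 0⟩ v)
    (h₁z : ∀ (t : R) (v : E), π₁ (Heisenberg.ofCenter (polar β) (Multiplicative.ofAdd t)) v = ((ψ t : Circle) : ℂ) • v)
    (h₁i : ∀ K : Submodule ℂ E, IsClosed (K : Set E) →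
      (∀ (h : Heisenberg (polar β)), ∀ v ∈ K, π₁ h v ∈ K) → K = ⊥ ∨ K = ⊤)
    {E₂ : Type*} [NormedAddCommGroup E₂] [InnerProductSpace ℂ E₂] (π₂ : Representation ℂ (Heisenberg (polar β)) E₂)
    (U₁ U₂ : E ≃ₗᵢ[ℂ] E₂) (hU₁ : ∀ (h : Heisenberg (polar β)) (v : E), U₁ (π₁ h v) = π₂ h (U₁ v))
    (hU₂ : ∀ (h : Heisenberg (polar β)) (v : E), U₂ (π₁ h v) = π₂ h (U₂ v)) :
    ∃ c : ℂ, ‖c‖ = 1 ∧ ∀ v : E, U₂ v = c • U₁ v := by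
  set A : E →L[ℂ] E := ((U₂.trans U₁.symm).toContinuousLinearEquiv : E →L[ℂ] E) with hAdef
  have hAv : ∀ v, A v = U₁.symm (U₂ v) := fun v => rfl
  have hA : ∀ (h : Heisenberg (polar β)) (v : E), A (π₁ h v) = π₁ h (A v) := by
    intro h v
    rw [hAv, hAv, hU₂]
    apply U₁.injective
    rw [LinearIsometryEquiv.apply_symm_apply, hU₁, LinearIsometryEquiv.apply_symm_apply]
  obtain ⟨c, hc⟩ := exists_commutant_eq_smul β ψ hB hX hY π₁ h₁u h₁c h₁z h₁i A hA
  have hU : ∀ v : E, U₂ v = c • U₁ v := fun v => by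
    have h := hc v
    rw [hAv] at h
    have h2 := congrArg U₁ h
    rwa [LinearIsometryEquiv.apply_symm_apply, map_smul] at h2
  obtain ⟨v, hv⟩ := exists_ne (0 : E)
  refine ⟨c, ?_, hU⟩
  have h := congrArg (fun x => ‖x‖) (hU v)
  simp only [LinearIsometryEquiv.norm_map, norm_smul] at h
  have hv' : ‖v‖ ≠ 0 := norm_ne_zero_iff.2 hv
  field_simp at h
  linarith [h]

end Commutant

end Literature.RepresentationTheory.HeisenbergGroup

end
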